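import Summits.BirchSwinnertonDyer.BirchSwinnertonDyer.Theorems.ClassRecordThreeEulerHalvesAtThreeKolyImageOrderBoundShiftDiv
import Summits.BirchSwinnertonDyer.BirchSwinnertonDyer.Theorems.ClassRecordThreeCornerAtThreeKolyImageOrderShaShift
import HarnessLib
/-!
# The IMAGE-KEYED Kolyvagin ORDER machine WITH GLOBAL DIVISIBILITY (D2 of the «SHIFT×DIV» merge): `Ш(E/K)[p^∞]` finite,
# killed by `p^{M₀}`, `#Ш(E/K)[p^∞] ≤ p^{2(M₀−t)}`, `ord_p #Ш(E/K)[p^∞] + 2t ≤ 2M₀` when every Kolyvagin class is killed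
# by `p^{2M₀−t}` (crux `EulerHalvesAtThree`, item stmt-BirchSwinnertonDyer-19109, road to DERIVE the r3 stub
# `stub_inertSavingDisplayAtThree`; cell `bsd-stepL`, seat `bsd-stepL-tam3-p1` g11; `--supports … --as helper`)

HONEST FRAMING: ONE THEOREM (+ private copies of the parent's three folklore helpers; no definition, no named fact, no
`sorry`); nothing here is a BSD class theorem; no census label moves (T7); item 19109 is NOT closed; CONDITIONAL on the
displayed binders exactly as the parents. BSD is not proved by any of this.

## THIS FILE (see D1 `…KolyImageOrderBoundShiftDiv.lean` for the series rationale)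
`card_sha_primaryComponent_le_of_localTerm_shift_ofImage_of_pow_smul_cl_eq_zero` — corner3-p2 g5's
`card_sha_primaryComponent_le_of_localTerm_shift_ofImage` (`…KolyImageOrderShaShift.lean`) VERBATIM with tam3-p1 g9's
divisibility delta (`Literature/…/HeegnerPointsKolyvaginPrimaryShaBoundDivisibleProofs.lean`): binders `(t) (ht : t ≤ M₀)
(hdivt)`, conclusions sharpened by `2t`, the quotient bound taken from D1.
[cite: McCallumLMS1991, §1 Theorem (Kolyvagin), Thm. 5.4, Cor. 5.6] [cite: Jetchev2008, p. 812 (1), Cor. 1.5]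
[cite: GrossLMS1991, §2 Thm. 2.2 (2)] [cite: MilneADT2006, Ch. I §6 (6.14), Prop. 6.9, Thm. 6.13(a)]
presearch: as the parents (bookkeeping merge).
-/

noncomputable section

open scoped Classical AddSubgroup
set_option linter.dupNamespace false

universe u

namespace Summit.BirchSwinnertonDyer.BirchSwinnertonDyer.Theorems.ShimuraKolyvaginOfImage

open Summit.BirchSwinnertonDyer.BirchSwinnertonDyer.Theorems.ShimuraKolyvaginOrder
open CategoryTheory _root_.WeierstrassCurve Field Function NumberField IsDedekindDomain
open Literature.NumberTheory.EllipticCurves Literature.NumberTheory.EllipticCurves.KolyvaginDescent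
open Literature.NumberTheory.GaloisRepresentations Literature.NumberTheory.GaloisCohomology
open Literature.NumberTheory.GaloisRepresentations.DiscreteGaloisModule (mu MuCarrier pairing)
open Literature.GroupTheory.FiniteAbelian
open Summit.BirchSwinnertonDyer.BirchSwinnertonDyer.Theorems
open scoped ContRepresentation

/-! ### `Ш[m²] ⊆ Ш[m] ⟹ Ш[m^∞] = Ш[m]` (copies of the tree's private helpers of `…PrimaryShaBoundProofs`) -/

section Descent

variable {K : Type} [Field K] [NumberField K] {W : WeierstrassCurve K} {m : ℕ}

/-- **`Ш[m²] ⊆ Ш[m]` implies `Ш[m^{k+1}] ⊆ Ш[m]`** (induction: if `m^{k+2} a = 0` then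
`m² (m^k a) = 0`, so `m (m^k a) = m^{k+1} a = 0`). [folklore] -/
private theorem zsmul_eq_zero_of_pow_zsmul_eq_zero_div
    (hL : ∀ a ∈ W.sha, (((m * m : ℕ) : ℤ)) • a = 0 → (m : ℤ) • a = 0) :
    ∀ (k : ℕ), ∀ a ∈ W.sha, ((m : ℤ) ^ (k + 1)) • a = 0 → (m : ℤ) • a = 0 := by
  intro k
  induction k with
  | zero =>
    intro a _ h
    simpa only [zero_add, pow_one] using h
  | succ k ih =>
    intro a ha h
    refine ih a ha ?_
    have hb : ((m : ℤ) ^ k) • a ∈ W.sha := W.sha.zsmul_mem ha _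
    have h2 : (((m * m : ℕ) : ℤ)) • (((m : ℤ) ^ k) • a) = 0 := by
      rw [← mul_zsmul, Nat.cast_mul, show (m : ℤ) * m * (m : ℤ) ^ k = (m : ℤ) ^ (k + 1 + 1) by ring, h]
    have h3 := hL _ hb h2
    rwa [← mul_zsmul, ← pow_succ'] at h3

/-- **With `m = p^{M₀}`, `M₀ ≥ 1`: every class of `Ш(E/K)[p^∞]` is killed by `p^{M₀}`** (a class
killed by `p^j` is killed by `(p^{M₀})^{j+1}`, hence by `p^{M₀}`). Here `Ш(E/K)[p^∞]` is Mathlib's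
`AddCommGroup.primaryComponent`: the classes killed by some power of `p`. [folklore] -/
private theorem nsmul_eq_zero_of_mem_primaryComponent_div {p M₀ : ℕ} (hM₀ : 1 ≤ M₀)
    (hL : ∀ a ∈ W.sha, (((p ^ M₀ * p ^ M₀ : ℕ) : ℤ)) • a = 0 → ((p ^ M₀ : ℕ) : ℤ) • a = 0)
    {c : W.sha} (hc : c ∈ AddCommGroup.primaryComponent W.sha p) : p ^ M₀ • c = 0 := by
  obtain ⟨j, hj⟩ := (AddCommGroup.mem_primaryComponent).1 hc
  have hdvd : p ^ j ∣ (p ^ M₀) ^ (j + 1) := by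
    rw [← pow_mul]
    exact pow_dvd_pow p (by nlinarith)
  obtain ⟨d, hd⟩ := hdvd
  have hpow : (((p ^ M₀ : ℕ) : ℤ) ^ (j + 1)) • (c : W.galH1) = 0 := by
    rw [← Nat.cast_pow, hd, mul_comm, Nat.cast_mul, mul_zsmul, natCast_zsmul, natCast_zsmul,
      ← AddSubgroupClass.coe_nsmul, hj, ZeroMemClass.coe_zero, nsmul_zero]
  have key := zsmul_eq_zero_of_pow_zsmul_eq_zero_div (W := W) (m := p ^ M₀) hL j (c : W.galH1) c.2 hpow
  rw [natCast_zsmul, ← AddSubgroupClass.coe_nsmul] at key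
  exact_mod_cast key

/-- Hence **`Ш(E/K)[p^∞] = Ш(E/K)[p^{M₀}]`** as far as cardinality goes (the two subtypes are in
bijection by the identity on classes). [folklore] -/
private theorem card_primaryComponent_eq_card_torsionBy_div {p M₀ : ℕ} (hM₀ : 1 ≤ M₀)
    (hL : ∀ a ∈ W.sha, (((p ^ M₀ * p ^ M₀ : ℕ) : ℤ)) • a = 0 → ((p ^ M₀ : ℕ) : ℤ) • a = 0) :
    Nat.card (AddCommGroup.primaryComponent W.sha p) = Nat.card (W.sha)[(p ^ M₀ : ℕ)] :=
  Nat.card_congr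
    { toFun := fun c => ⟨c.1, AddSubgroup.torsionBy.nsmul_iff.2
        (nsmul_eq_zero_of_mem_primaryComponent_div hM₀ hL c.2)⟩
      invFun := fun x => ⟨x.1, (AddCommGroup.mem_primaryComponent).2
        ⟨M₀, AddSubgroup.torsionBy.nsmul_iff.1 x.2⟩⟩
      left_inv := fun _ => rfl
      right_inv := fun _ => rfl }

end Descent

/-! ### McCallum's §1 Theorem, order form, on `Ш(E/K)[p^∞]`, conductor-keyed -/


variable (W : WeierstrassCurve ℚ) {K : Type} [Field K] [NumberField K]

/-- **Kolyvagin's theorem on `Ш(E/K)[p^∞]` REFINED BY GLOBAL DIVISIBILITY (McCallum 1991 Cor. 5.6 with `m ≥ t`; Jetchev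
2008 (1)), conductor-keyed, depth `2M₀ + k`, image-keyed** — corner3-p2 g5's `card_sha_primaryComponent_le_of_localTerm_shift_ofImage`
VERBATIM with g9's delta (`…ShaBoundDivisibleProofs`): added binders `(t) (ht : t ≤ M₀) (hdivt)` (every Kolyvagin class on
depth-`(2M₀+k)` primes killed by `p^{2M₀−t}`), conclusions `#Ш(E/K)[p^∞] ≤ p^{2(M₀−t)}` and `ord_p #Ш(E/K)[p^∞] + 2t ≤ 2M₀`;
the quotient bound is D1's `card_quotient_selmer_le_of_localTerm_shift_ofImage_of_pow_smul_cl_eq_zero`.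
[cite: McCallumLMS1991, §1 Theorem; Thm. 5.4, Cor. 5.6] [cite: Jetchev2008, p. 812 (1) and Cor. 1.5]
[cite: MilneADT2006, Ch. I §6, (6.14), Prop. 6.9, Thm. 6.13(a)] -/
theorem card_sha_primaryComponent_le_of_localTerm_shift_ofImage_of_pow_smul_cl_eq_zero [W.IsElliptic]
    (hK : IsImaginaryQuadratic K) {N₀ : ℕ} [NeZero N₀] (hN : W.conductorNorm ℤ = N₀) (k : ℕ)
    {Pt : (W.baseChange K).toAffine.Point}
    {p : ℕ} (hp : p.Prime) (hp2 : p ≠ 2) (hIz : ∃ z : Field.absoluteGaloisGroup K, ∀ t : geomTorsion (W.baseChange K) p, z • t = -t)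
    (hIs : (W.baseChange K).HasIrreducibleModPGaloisRep p)
    (hIc : ∀ f : geomTorsion (W.baseChange K) p →+ geomTorsion (W.baseChange K) p,
      (∀ (g : Field.absoluteGaloisGroup K) (t : geomTorsion (W.baseChange K) p), f (g • t) = g • f t) →
        ∃ k : ℤ, ∀ t, f t = k • t)
    (hIt : AddSubgroup.torsionBy (W.baseChange K).toAffine.Point (p : ℤ) = ⊥)
    (hC : Literature.NumberTheory.Automorphic.chebotarev_artinRep) (hW : W.exists_weilPairing p)
    {M₀ : ℕ} (hM₀ : 1 ≤ M₀) [NeZero (p ^ M₀)]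
    (hdiv : ∀ Q : geomPoints (W.baseChange K), ∃ R, ((p ^ M₀ * p ^ M₀ : ℕ) : ℤ) • R = Q)
    {c : K ≃ₐ[ℚ] K} (hc : c ≠ 1) (hcc : c * c = 1)
    {x₀ : (W.baseChange K).toAffine.Point} (hx₀ : p ^ M₀ • x₀ = Pt)
    (hPx : kummerMapTorsion (W.baseChange K) _ hdiv Pt =
      ((p : ℤ) ^ M₀) • kummerMapTorsion (W.baseChange K) _ hdiv x₀)
    (hxord : ((p : ℤ) ^ (2 * M₀ - 1)) • kummerMapTorsion (W.baseChange K) _ hdiv x₀ ≠ 0)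
    (ε : ℤ) (hε : ε = 1 ∨ ε = -1)
    (h53 : IsOfFinAddOrder (Affine.Point.map (W' := W) (c : K →ₐ[ℚ] K) Pt - ε • Pt))
    (cl : ℕ → galH1Torsion (W.baseChange K) ((p ^ M₀ * p ^ M₀ : ℕ) : ℤ))
    (hc1 : cl 1 = kummerMapTorsion (W.baseChange K) _ hdiv Pt)
    (hcl : ∀ m : ℕ, Squarefree m →
      (∀ q ∈ m.primeFactors, IsKolyvaginPrime N₀ W K p q ∧ FrobEqFrobInfty W K (p ^ (2 * M₀ + k)) q) →
      conjAct W c _ (cl m) = (ε * (-1) ^ m.primeFactors.card) • cl m ∧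
      (∀ v : HeightOneSpectrum (𝓞 K), (m : 𝓞 K) ∉ v.asIdeal →
        cl m ∈ selmerLocalKer (W.baseChange K) (v.adicCompletion K) ((p ^ M₀ * p ^ M₀ : ℕ) : ℤ)) ∧
      (∀ ℓ : ℕ, ℓ.Prime → ℓ ∣ m → ∀ v : HeightOneSpectrum (𝓞 K), (ℓ : 𝓞 K) ∈ v.asIdeal →
        ∀ a : ℕ, (((p : ℤ) ^ a) • cl m ∈
            selmerLocalKer (W.baseChange K) (v.adicCompletion K) ((p ^ M₀ * p ^ M₀ : ℕ) : ℤ) ↔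
          ((p : ℤ) ^ a) • cl (m / ℓ) ∈
            (W.baseChange K).torsionLocalKer (v.adicCompletion K) ((p ^ M₀ * p ^ M₀ : ℕ) : ℤ))))
    (hdual : ∀ ℓ : ℕ, IsKolyvaginPrime N₀ W K p ℓ ∧ FrobEqFrobInfty W K (p ^ (2 * M₀ + k)) ℓ →
      ∀ ν : ℤ, (ν = 1 ∨ ν = -1) → ∀ d : galH1Torsion (W.baseChange K) ((p ^ M₀ * p ^ M₀ : ℕ) : ℤ),
      conjAct W c _ d = ν • d →
      (∀ v : HeightOneSpectrum (𝓞 K), (ℓ : 𝓞 K) ∉ v.asIdeal →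
        d ∈ selmerLocalKer (W.baseChange K) (v.adicCompletion K) ((p ^ M₀ * p ^ M₀ : ℕ) : ℤ)) →
      (∀ w : InfinitePlace K,
        d ∈ selmerLocalKer (W.baseChange K) w.Completion ((p ^ M₀ * p ^ M₀ : ℕ) : ℤ)) →
      ∀ s ∈ selmerGroup (W.baseChange K) ((p ^ M₀ * p ^ M₀ : ℕ) : ℤ), conjAct W c _ s = ν • s →
      ∀ a : ℕ, a < 2 * M₀ → ∀ v : HeightOneSpectrum (𝓞 K), (ℓ : 𝓞 K) ∈ v.asIdeal →
        ((p : ℤ) ^ a) • d ∉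
          selmerLocalKer (W.baseChange K) (v.adicCompletion K) ((p ^ M₀ * p ^ M₀ : ℕ) : ℤ) →
        ((p : ℤ) ^ (2 * M₀ - 1 - a)) • s ∈
          (W.baseChange K).torsionLocalKer (v.adicCompletion K) ((p ^ M₀ * p ^ M₀ : ℕ) : ℤ))
    -- the Cassels–Tate inputs at level `m = p^{M₀}`, auxiliary level `m² = p^M`
    (e : geomTorsion (W.baseChange K) ((p ^ M₀ * p ^ M₀ : ℕ) : ℤ) →
      geomTorsion (W.baseChange K) ((p ^ M₀ * p ^ M₀ : ℕ) : ℤ) → AlgebraicClosure K)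
    (hμ : ∀ S T, e S T ^ (p ^ M₀ * p ^ M₀) = 1)
    (hadd₁ : ∀ S₁ S₂ T, e (S₁ + S₂) T = e S₁ T * e S₂ T)
    (hadd₂ : ∀ S T₁ T₂, e S (T₁ + T₂) = e S T₁ * e S T₂)
    (hgal : ∀ (σ : absoluteGaloisGroup K) (S T : geomTorsion (W.baseChange K) ((p ^ M₀ * p ^ M₀ : ℕ) : ℤ)),
      σ • e S T = e (σ • S) (σ • T))
    (halt : ∀ T, e T T = 1)
    (inv : LocalInvariants K (p ^ M₀ * p ^ M₀)) (hPT' : inv.SumInvLocalizationEqZero)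
    (hH3 : ∀ x : galoisCohomology (mu K (p ^ M₀ * p ^ M₀)) 3,
      (∀ v : Place K, galoisCohomology.localization (mu K (p ^ M₀ * p ^ M₀)) v 3 x = 0) → x = 0)
    (hB : IsLevelPairing (p ^ M₀)
      (ctLevelPairing (W.baseChange K) (p ^ M₀) e hμ hadd₁ hadd₂ hgal inv halt hPT' hH3
        (localTerm_finite_support (W := W.baseChange K) (m := p ^ M₀) (e := e) (hμ := hμ)
          (hadd₁ := hadd₁) (hadd₂ := hadd₂) (hgal := hgal) halt inv)))
    (hPτ : ∀ z ∈ selmerGroup (W.baseChange K) ((p ^ M₀ * p ^ M₀ : ℕ) : ℤ),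
      ∀ t ∈ selmerGroup (W.baseChange K) ((p ^ M₀ * p ^ M₀ : ℕ) : ℤ),
      ctGeneralFun (W.baseChange K) (p ^ M₀) e hμ hadd₁ hadd₂ hgal inv
          (torsionH1ToH1 (W.baseChange K) _ (conjAct W c _ z))
          (torsionH1ToH1 (W.baseChange K) _ (conjAct W c _ t)) =
        ctGeneralFun (W.baseChange K) (p ^ M₀) e hμ hadd₁ hadd₂ hgal inv
          (torsionH1ToH1 (W.baseChange K) _ z) (torsionH1ToH1 (W.baseChange K) _ t))
    -- Kolyvagin's annihilation, in the two forms used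
    (hkill : ∀ s ∈ selmerGroup (W.baseChange K) ((p ^ M₀ * p ^ M₀ : ℕ) : ℤ),
      ((p : ℤ) ^ M₀) • s ∈ AddSubgroup.zmultiples (kummerMapTorsion (W.baseChange K) _ hdiv x₀))
    (hL : ∀ a ∈ (W.baseChange K).sha, (((p ^ M₀ * p ^ M₀ : ℕ) : ℤ)) • a = 0 → ((p ^ M₀ : ℕ) : ℤ) • a = 0)
    -- McCallum's Lemma 5.3 for the Cassels–Tate local term at `λ`
    (hloc : ∀ ℓ m : ℕ,
      (hℓ : IsKolyvaginPrime N₀ W K p ℓ ∧ FrobEqFrobInfty W K (p ^ (2 * M₀ + k)) ℓ) →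
      KolSupp (fun q => IsKolyvaginPrime N₀ W K p q ∧ FrobEqFrobInfty W K (p ^ (2 * M₀ + k)) q) (ℓ * m) →
      ¬ ℓ ∣ m →
      ∀ (j N a b : ℕ) (t : galH1Torsion (W.baseChange K) ((p ^ M₀ * p ^ M₀ : ℕ) : ℤ)),
      t ∈ selmerGroup (W.baseChange K) ((p ^ M₀ * p ^ M₀ : ℕ) : ℤ) →
      ((p : ℤ) ^ j) • cl (ℓ * m) ∈ selmerGroup (W.baseChange K) ((p ^ M₀ * p ^ M₀ : ℕ) : ℤ) →
      ((p : ℤ) ^ N) • t = 0 →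
      conjAct W c ((p ^ M₀ * p ^ M₀ : ℕ) : ℤ) t = (ε * (-1) ^ (ℓ * m).primeFactors.card) • t →
      (∀ q ∈ m.primeFactors, ∀ v : HeightOneSpectrum (𝓞 K), (q : 𝓞 K) ∈ v.asIdeal →
        t ∈ (W.baseChange K).torsionLocalKer (v.adicCompletion K) ((p ^ M₀ * p ^ M₀ : ℕ) : ℤ)) →
      M₀ ≤ j → N ≤ M₀ → N ≤ j → a + b + 1 = N →
      (¬ ∀ v : HeightOneSpectrum (𝓞 K), (ℓ : 𝓞 K) ∈ v.asIdeal →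
        ((p : ℤ) ^ (a + (j - N))) • cl m ∈
          (W.baseChange K).torsionLocalKer (v.adicCompletion K) ((p ^ M₀ * p ^ M₀ : ℕ) : ℤ)) →
      (¬ ∀ v : HeightOneSpectrum (𝓞 K), (ℓ : 𝓞 K) ∈ v.asIdeal →
        ((p : ℤ) ^ b) • t ∈ (W.baseChange K).torsionLocalKer (v.adicCompletion K) ((p ^ M₀ * p ^ M₀ : ℕ) : ℤ)) →
      ∀ D : FirstCaseData (W.baseChange K) (p ^ M₀), D.b₁ = ((p : ℤ) ^ (j - M₀)) • cl (ℓ * m) →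
        galoisCohomology.map (inclKD (W.baseChange K) (p ^ M₀) (p ^ M₀)) 1 D.b' = t →
        D.localTerm e hμ hadd₁ hadd₂ hgal inv (Sum.inr hℓ.1.place) ≠ 0)
    -- GLOBAL DIVISIBILITY to depth `t ≤ M₀`: every Kolyvagin class (depth-`(2M₀ + k)` primes) is killed by `p^{2M₀ − t}`
    (t : ℕ) (ht : t ≤ M₀)
    (hdivt : ∀ m : ℕ, Squarefree m →
      (∀ q ∈ m.primeFactors, IsKolyvaginPrime N₀ W K p q ∧ FrobEqFrobInfty W K (p ^ (2 * M₀ + k)) q) →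
      ((p : ℤ) ^ (2 * M₀ - t)) • cl m = 0) :
    Finite (AddCommGroup.primaryComponent (W.baseChange K).sha p) ∧
    (∀ c ∈ AddCommGroup.primaryComponent (W.baseChange K).sha p, p ^ M₀ • c = 0) ∧
    Nat.card (AddCommGroup.primaryComponent (W.baseChange K).sha p) ≤ p ^ (2 * (M₀ - t)) ∧
    padicValNat p (Nat.card (AddCommGroup.primaryComponent (W.baseChange K).sha p)) + 2 * t ≤
      2 * M₀ := by
  have hn0 : ((p ^ M₀ * p ^ M₀ : ℕ) : ℤ) ≠ 0 := by
    exact_mod_cast mul_ne_zero (NeZero.ne _) (NeZero.ne _)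
  have hEND := card_quotient_selmer_le_of_localTerm_shift_ofImage_of_pow_smul_cl_eq_zero W hK hN k hp hp2 hIz hIs hIc
    hIt hC hW hM₀ hdiv hc hcc hx₀ hPx
    hxord ε hε h53 cl hc1 hcl hdual e hμ hadd₁ hadd₂ hgal halt inv hPT' hH3 hB hPτ hkill hL hloc t (by omega) hdivt
  haveI : Finite (selmerGroup (W.baseChange K) ((p ^ M₀ * p ^ M₀ : ℕ) : ℤ)) :=
    (W.baseChange K).finite_selmerGroup_holds hn0
  obtain ⟨ι, hι⟩ := exists_selmerToShaTorsion (W.baseChange K) (p ^ M₀) hL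
  have hx : torsionH1ToH1 (W.baseChange K) _ (kummerMapTorsion (W.baseChange K) _ hdiv x₀) = 0 :=
    torsionH1ToH1_kummerMapTorsion (W.baseChange K) _ hdiv x₀
  have hcard : Nat.card (AddCommGroup.primaryComponent (W.baseChange K).sha p) ≤ p ^ (2 * (M₀ - t)) := by
    rw [card_primaryComponent_eq_card_torsionBy_div hM₀ hL]
    exact (card_shaTorsion_le_card_quotient ι hι hx).trans hEND
  have hfin : Finite (AddCommGroup.primaryComponent (W.baseChange K).sha p) := by
    haveI : Finite ((W.baseChange K).sha)[(p ^ M₀ : ℕ)] := finite_shaTorsion_of_finite_selmerGroup ι hι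
    exact Nat.finite_of_card_ne_zero (by
      rw [card_primaryComponent_eq_card_torsionBy_div hM₀ hL]
      exact Nat.card_pos.ne')
  refine ⟨hfin, fun c hc => nsmul_eq_zero_of_mem_primaryComponent_div hM₀ hL hc, hcard, ?_⟩
  have hv : padicValNat p (Nat.card (AddCommGroup.primaryComponent (W.baseChange K).sha p)) ≤
      2 * (M₀ - t) :=
    (padicValNat_le_nat_log _).trans ((Nat.log_mono_right hcard).trans_eq (Nat.log_pow hp.one_lt _))
  omega

end Summit.BirchSwinnertonDyer.BirchSwinnertonDyer.Theorems.ShimuraKolyvaginOfImage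

end
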